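import Summits.Ventures.PercRepro.LemmaBPlusK5Def

/-!
# Faces of `K₅`: kernel slices 48 … 51 (part M)

Each theorem is one `decide +kernel` at default heartbeats (≈ 55 s: the 1024-row table of the marking
plus ≤ 22 000 face points in sub-mask loops); generated by `tools/gen_k5.py`.
-/

namespace PercRepro

namespace Examples

open MultiGraph

/-- Slice 48: joins `u ∈ [1020, 1021)` of the faces of `K₅` (6561 face points). -/
theorem k5_slice_48 : k5.FacesSRange ![0, 1, 2, 3] 1020 1021 := by decide +kernel

/-- Slice 49: joins `u ∈ [1021, 1022)` of the faces of `K₅` (19683 face points). -/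
theorem k5_slice_49 : k5.FacesSRange ![0, 1, 2, 3] 1021 1022 := by decide +kernel

/-- Slice 50: joins `u ∈ [1022, 1023)` of the faces of `K₅` (19683 face points). -/
theorem k5_slice_50 : k5.FacesSRange ![0, 1, 2, 3] 1022 1023 := by decide +kernel

/-- Slice 51: the join `u = 1023` (all edges), meets `v ∈ [0, 164)` (21960 face points). -/
theorem k5_slice_51 : k5.FacesSRangeV ![0, 1, 2, 3] 1023 0 164 := by decide +kernel

end Examples

end PercRepro
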